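import Summits.BirchSwinnertonDyer.BirchSwinnertonDyer.Theorems.ByReductionTypeAtTwoRankOneAtTwoBigImageOddLocalOneDoorBottomPosAssembly
import Summits.BirchSwinnertonDyer.BirchSwinnertonDyer.Theorems.ByReductionTypeAtTwoRankOneAtTwoOneDoorFirstDescentPosDefs
import HarnessLib

/-!
# Route ByReductionTypeAtTwo, crux `RankOneAtTwoBigImageOddLocal` (stmt-BirchSwinnertonDyer-23715), LINE v8.11 `one_door_analytic`:
# U₀⁺ REDUCED TO THE FIRST-LAYER CLASSES AT REGULAR PRIMES — `FirstDescentLeavesAtTwoBottomPos ⟸ FirstLayerClassesAtTwoBottomPos`, BY NAME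

Width prover seat `bsd-line-fkl-p2` g11 (2026-08-28), `--supports stmt-BirchSwinnertonDyer-23715` (helper).  THEOREMS ONLY; no definition, no
named fact introduced, no `sorry`; BSD is not proved by any of this.

The lead's `Theorems/…OneDoorFirstDescentPosDefs.lean` (v8.11) types the REGULAR Kolyvagin primes `KolPos W K ℓ := jacobiSym W.Δ.num ℓ = -1 ∧
Zhang2014.IsKolyvaginPrime (W.conductorNorm ℤ) W K 2 ℓ ∧ 1 ≤ Zhang2014.kolyvaginIndex W 2 ℓ` (VERBATIM the output of the width seat's supply
`…OneDoorBottomPosCebotarev`) and the statement `FirstLayerClassesAtTwoBottomPos` (VERBATIM the displayed input of `nonempty_firstDescentInput_pos`,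
`…OneDoorBottomPosAssembly`).  This file states the reduction of the registered stub `stub_firstDescentLeavesPos` BY NAME:

* `firstDescentLeavesAtTwoBottomPos_of_firstLayerClassesPos : GZ∀ → Ko∀ → exists_isNewformOf → HL → FirstLayerClassesAtTwoBottomPos →
  FirstDescentLeavesAtTwoBottomPos` (definitional unfolding of `KolPos` into `firstDescentLeavesAtTwoBottomPos_of_classes`),

so that a skeleton v8.12 can carry `stub_firstLayerClassesPos : FirstLayerClassesAtTwoBottomPos` (the `Δ_W > 0` twin of the 24880 face, at regular
primes) in place of `stub_firstDescentLeavesPos`, exactly as v8.10 did on the `Δ_W < 0` side (`firstDescentLeavesAtTwoBottomNeg_of_classes`).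

References: [GrossLMS1991] §10; [McCallumLMS1991] Cor. 3.2, Lemma 5.3; [Kramer1981] Prop. 6; [Kolyvagin1989Izv] §3.
-/

set_option autoImplicit false
-- the Theorems namespace of this sub repeats the summit name by design (D-0017 nested layout)
set_option linter.dupNamespace false

noncomputable section

open scoped Classical

namespace Summit.BirchSwinnertonDyer.BirchSwinnertonDyer.Theorems.RankOneAtTwoOneDoor

open WeierstrassCurve NumberField IsDedekindDomain Literature.NumberTheory.EllipticCurves Literature.NumberTheory.EllipticCurves.ModularForms
  Literature.NumberTheory.GaloisRepresentations Literature.NumberTheory.EllipticCurves.KrizLi2019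
  Summit.BirchSwinnertonDyer.Rank1Residual.F1Sign2
  Summit.BirchSwinnertonDyer.Rank1Residual.F1Sign2.TranspositionDoor

/-- **U₀⁺ reduced to the first-layer classes at regular primes, BY NAME**: `FirstDescentLeavesAtTwoBottomPos` (the registered stub
`stub_firstDescentLeavesPos` of skeleton v8.10/v8.11) follows from `FirstLayerClassesAtTwoBottomPos` (the `Δ_W > 0` first-layer face at REGULAR
Kolyvagin primes `KolPos`) modulo Gross–Zagier, Kolyvagin, modularity as a newform and Hoffstein–Luo — the whole U₀⁺ assembly
(`nonempty_firstDescentInput_pos`: error place `∞`, regular-prime Čebotarev supply, `line_inr`/`rec_inr` leaves, Heegner class) is kernel glue.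
[cite: GrossLMS1991, §10] [cite: McCallumLMS1991, Cor. 3.2] [cite: Kramer1981, Prop. 6] -/
theorem firstDescentLeavesAtTwoBottomPos_of_firstLayerClassesPos
    (hGZ : ∀ (N : ℕ) [NeZero N] (W : WeierstrassCurve ℚ) (K : Type) [Field K] [NumberField K], gross_zagier N W K)
    (hKo : ∀ (N : ℕ) [NeZero N] (W : WeierstrassCurve ℚ) (K : Type) [Field K] [NumberField K], kolyvagin N W K)
    (hnf : exists_isNewformOf) (hHL : HoffsteinLuo1997_exists_twist_L_one_ne_zero)
    (hcl : FirstLayerClassesAtTwoBottomPos) : FirstDescentLeavesAtTwoBottomPos :=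
  firstDescentLeavesAtTwoBottomPos_of_classes hGZ hKo hnf hHL
    (fun W _ _ _ hCM hsurj hT hc hr K _ _ hK hadm hLt Dt H ι P hP Wd _ _ Cd hWd hmin hodd hm hΔ w₀ hdivK y hymem hyres =>
      hcl W hCM hsurj hT hc hr K hK hadm hLt Dt H ι P hP Wd Cd hWd hmin hodd hm hΔ w₀ hdivK y hymem hyres)

end Summit.BirchSwinnertonDyer.BirchSwinnertonDyer.Theorems.RankOneAtTwoOneDoor

end
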